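import Summits.CriticalPhenomena.PercolationContinuityZ3.Theorems.PercAnnulusCrossingIICTargetLevelTwoSided
import Summits.CriticalPhenomena.PercolationContinuityZ3.Theorems.PercAnnulusCrossingIICAspectSchemeLevel
import HarnessLib

/-!
# Kesten–Basu–Sapozhnikov IIC scheme in boxes with a GENERAL CONDITIONING TARGET, XIII″: one level of Kesten's scheme (lane RSW3, p1 gen 4)

builds on p205010 (kernel theorem, internal audit signed; external expert review pending)

Seat `prim-rsw3-p1` (gen 4).  Part XIII′ (`PercAnnulusCrossingIICAspectSchemeLevel.lean`) with the level vectors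
`γ_n(D) = P(CONN(D;n))` replaced by `γ_{W,T}(D) = P(CONN(D;W,T))`, `CONN(H,X;W,T) = {∃ x ∈ X, ∃ t ∈ T, x ↔ t in W ∖ H}` for finite
`W ⊇ Λ(τ M₂)` and `T ⊆ W ∖ Λ(τ M₂)` (Basu–Sapozhnikov Remark 2.1).  The kernel `M(C;D)` does not involve the target, so the rank-one
sandwich `mul_le_kernel_and_kernel_le_mul_aspect` of part XIII′ is reused.  Helper file; no definitions, no sorries.
* **`sum_kernel_mul_conn_two_sided_target`** — `(1 − ϰ⁻²(α(σ μ₁, σ μ₂) + α(σ M₁, σ M₂))) · γ_{W,T}(C) ≤ Σ_D M(C;D) γ_{W,T}(D) ≤ γ_{W,T}(C)`.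
References: H. Kesten, PTRF 73 (1986) §2 eq. (22); D. Basu, A. Sapozhnikov, ECP 22 (2017) no. 26, §2 and Remark 2.1.
-/

noncomputable section

namespace Summit.CriticalPhenomena.PercolationContinuityZ3.Theorems.Crossing

open MeasureTheory Literature.Probability.Percolation Literature.Probability.LatticeModels
open Literature.Probability.Percolation.DCT16
open Summit.CriticalPhenomena.PercolationContinuityZ3.Theorems.SurfaceTension
open scoped Literature.Probability.Percolation

variable {d : ℕ}

/-- **One level of Kesten's scheme, general aspect and general conditioning target, two-sided** (eq. (22) with junk): see the
module docstring.
[cite: Kesten1986, §2 eq. (22)] [cite: BasuSapozhnikov2017ECP, §2 (2.5)–(2.7)] -/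
theorem sum_kernel_mul_conn_two_sided_target (p : unitInterval) {ϰ : ℝ} (hϰ : 0 < ϰ)
    {σ τ : ℕ → ℕ} (hσ : ∀ m : ℕ, 1 ≤ m → m < σ m) (hστ : ∀ m : ℕ, 1 ≤ m → σ m < τ m)
    (hσm : Monotone σ) (hτm : Monotone τ)
    (hA2 : ∀ m : ℕ, 1 ≤ m → ∀ Z : Finset (Site d), box d (τ m) \ box d (m - 1) ⊆ Z →
      ∀ X : Finset (Site d), X ⊆ Z ∩ box d m → ∀ Y : Finset (Site d), Y ⊆ Z \ box d (τ m) →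
        ϰ * (bondPercolation (zdGraph d) p).real {ω | ∃ x ∈ X, ∃ s ∈ innerBoundary (zdGraph d) (box d (σ m)),
              ω ∈ openConnIn (↑Z : Set (Site d)) x s} *
          (bondPercolation (zdGraph d) p).real {ω | ∃ y ∈ Y, ∃ s ∈ innerBoundary (zdGraph d) (box d (σ m)),
              ω ∈ openConnIn (↑Z : Set (Site d)) y s} ≤
        (bondPercolation (zdGraph d) p).real {ω | ∃ x ∈ X, ∃ y ∈ Y, ω ∈ openConnIn (↑Z : Set (Site d)) x y})
    {μ₁ μ₂ M₁ M₂ : ℕ} (hμ₁ : 1 ≤ μ₁) (hμ12 : τ μ₁ < σ μ₂) (hμM : μ₂ ≤ M₁) (hM12 : τ M₁ < σ M₂) {W T : Finset (Site d)}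
    (hW : box d (τ M₂) ⊆ W) (hTW : T ⊆ W) (hTb : ∀ t ∈ T, t ∉ box d (τ M₂))
    {H X : Finset (Site d)} (hH : H ⊆ box d (μ₁ - 1)) (hX : X ⊆ box d μ₁) (hXH : ∀ x ∈ X, x ∉ H) :
    (1 - ϰ⁻¹ ^ 2 * ((bondPercolation (zdGraph d) p).real (boxCrossing d (σ μ₁) (σ μ₂)) +
        (bondPercolation (zdGraph d) p).real (boxCrossing d (σ M₁) (σ M₂)))) *
        (bondPercolation (zdGraph d) p).real {ω : BondConfig (Site d) | ∃ x ∈ X, ∃ t ∈ T,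
            ω ∈ openConnIn ((↑W : Set (Site d)) \ ↑H) x t} ≤
      ∑ D ∈ ((box d (σ M₂)).powerset.filter (fun U => box d (σ M₁) ⊆ U)) ×ˢ (box d (σ M₂ + 1)).powerset,
        (bondPercolation (zdGraph d) p).real
        ((⋃ I ∈ (box d (σ μ₂ - 1) \ box d (σ μ₁ - 1)).powerset ×ˢ (innerBoundary (zdGraph d) (box d (σ μ₁ - 1))).powerset,
            ({ω : BondConfig (Site d) | ω ∩ (↑((box d (σ μ₂)).sym2) : Set (Sym2 (Site d))) ∈
                explEvent ((↑(box d (σ μ₂ - 1)) : Set (Site d))ᶜ) ((↑(box d (σ μ₂ - 1)) : Set (Site d)) \ ↑(box d (σ μ₁ - 1)))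
                  ((↑(box d (σ μ₂ - 1)) : Set (Site d))ᶜ ∪ ↑I.1) ↑I.2} ∩
             {ω : BondConfig (Site d) | ∀ y ∈ I.2, ∀ y' ∈ I.2, ∀ z ∈ I.1 ∪ innerBoundary (zdGraph d) (box d (σ μ₂)),
                ∀ z' ∈ I.1 ∪ innerBoundary (zdGraph d) (box d (σ μ₂)), s(z, y) ∈ ω → s(z', y') ∈ ω →
                ω ∈ openConnIn (↑(I.1 ∪ innerBoundary (zdGraph d) (box d (σ μ₂))) : Set (Site d)) z z'})) ∩
          ({ω : BondConfig (Site d) | ∃ x ∈ X, ∃ r ∈ D.2, ∃ v ∈ D.1, ω ∈ openConnIn ((↑D.1 : Set (Site d)) \ ↑H) x v ∧ s(v, r) ∈ ω} ∩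
           {ω : BondConfig (Site d) | ω ∩ (↑((box d (σ M₂ + 1)).sym2) : Set (Sym2 (Site d))) ∈
            explEvent (↑(box d (σ M₁)) : Set (Site d)) ((↑(box d (σ M₂)) : Set (Site d)) \ ↑(box d (σ M₁))) ↑D.1 ↑D.2} ∩
           {ω : BondConfig (Site d) | ∀ r ∈ D.2, ∀ r' ∈ D.2, ∃ v ∈ D.1, ∃ v' ∈ D.1,
            s(v, r) ∈ ω ∧ s(v', r') ∈ ω ∧ ω ∈ openConnIn ((↑D.1 : Set (Site d)) \ ↑(box d (σ M₁ - 1))) v v'})) *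
        (bondPercolation (zdGraph d) p).real {ω : BondConfig (Site d) | ∃ x ∈ D.2, ∃ t ∈ T,
            ω ∈ openConnIn ((↑W : Set (Site d)) \ ↑D.1) x t} ∧
    ∑ D ∈ ((box d (σ M₂)).powerset.filter (fun U => box d (σ M₁) ⊆ U)) ×ˢ (box d (σ M₂ + 1)).powerset,
        (bondPercolation (zdGraph d) p).real
        ((⋃ I ∈ (box d (σ μ₂ - 1) \ box d (σ μ₁ - 1)).powerset ×ˢ (innerBoundary (zdGraph d) (box d (σ μ₁ - 1))).powerset,
            ({ω : BondConfig (Site d) | ω ∩ (↑((box d (σ μ₂)).sym2) : Set (Sym2 (Site d))) ∈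
                explEvent ((↑(box d (σ μ₂ - 1)) : Set (Site d))ᶜ) ((↑(box d (σ μ₂ - 1)) : Set (Site d)) \ ↑(box d (σ μ₁ - 1)))
                  ((↑(box d (σ μ₂ - 1)) : Set (Site d))ᶜ ∪ ↑I.1) ↑I.2} ∩
             {ω : BondConfig (Site d) | ∀ y ∈ I.2, ∀ y' ∈ I.2, ∀ z ∈ I.1 ∪ innerBoundary (zdGraph d) (box d (σ μ₂)),
                ∀ z' ∈ I.1 ∪ innerBoundary (zdGraph d) (box d (σ μ₂)), s(z, y) ∈ ω → s(z', y') ∈ ω →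
                ω ∈ openConnIn (↑(I.1 ∪ innerBoundary (zdGraph d) (box d (σ μ₂))) : Set (Site d)) z z'})) ∩
          ({ω : BondConfig (Site d) | ∃ x ∈ X, ∃ r ∈ D.2, ∃ v ∈ D.1, ω ∈ openConnIn ((↑D.1 : Set (Site d)) \ ↑H) x v ∧ s(v, r) ∈ ω} ∩
           {ω : BondConfig (Site d) | ω ∩ (↑((box d (σ M₂ + 1)).sym2) : Set (Sym2 (Site d))) ∈
            explEvent (↑(box d (σ M₁)) : Set (Site d)) ((↑(box d (σ M₂)) : Set (Site d)) \ ↑(box d (σ M₁))) ↑D.1 ↑D.2} ∩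
           {ω : BondConfig (Site d) | ∀ r ∈ D.2, ∀ r' ∈ D.2, ∃ v ∈ D.1, ∃ v' ∈ D.1,
            s(v, r) ∈ ω ∧ s(v', r') ∈ ω ∧ ω ∈ openConnIn ((↑D.1 : Set (Site d)) \ ↑(box d (σ M₁ - 1))) v v'})) *
        (bondPercolation (zdGraph d) p).real {ω : BondConfig (Site d) | ∃ x ∈ D.2, ∃ t ∈ T,
            ω ∈ openConnIn ((↑W : Set (Site d)) \ ↑D.1) x t} ≤
      (bondPercolation (zdGraph d) p).real {ω : BondConfig (Site d) | ∃ x ∈ X, ∃ t ∈ T,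
            ω ∈ openConnIn ((↑W : Set (Site d)) \ ↑H) x t} := by
  classical
  have hσ1 := hσ μ₁ hμ₁
  have hστ1 := hστ μ₁ hμ₁
  have hμ12' : μ₁ < μ₂ := hσm.reflect_lt (by omega)
  have hσ2 := hσ μ₂ (by omega)
  have hστ2 := hστ μ₂ (by omega)
  have hσμM : σ μ₂ ≤ σ M₁ := hσm hμM
  have hτμM : τ μ₂ ≤ τ M₁ := hτm hμM
  have hσM1 := hσ M₁ (by omega)
  have hστM1 := hστ M₁ (by omega)
  have hM12' : M₁ < M₂ := hσm.reflect_lt (by omega)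
  have hσM2 := hσ M₂ (by omega)
  have hστM2 := hστ M₂ (by omega)
  set μ := bondPercolation (zdGraph d) p with hμ
  set G := (⋃ I ∈ (box d (σ μ₂ - 1) \ box d (σ μ₁ - 1)).powerset ×ˢ (innerBoundary (zdGraph d) (box d (σ μ₁ - 1))).powerset,
            ({ω : BondConfig (Site d) | ω ∩ (↑((box d (σ μ₂)).sym2) : Set (Sym2 (Site d))) ∈
                explEvent ((↑(box d (σ μ₂ - 1)) : Set (Site d))ᶜ) ((↑(box d (σ μ₂ - 1)) : Set (Site d)) \ ↑(box d (σ μ₁ - 1)))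
                  ((↑(box d (σ μ₂ - 1)) : Set (Site d))ᶜ ∪ ↑I.1) ↑I.2} ∩
             {ω : BondConfig (Site d) | ∀ y ∈ I.2, ∀ y' ∈ I.2, ∀ z ∈ I.1 ∪ innerBoundary (zdGraph d) (box d (σ μ₂)),
                ∀ z' ∈ I.1 ∪ innerBoundary (zdGraph d) (box d (σ μ₂)), s(z, y) ∈ ω → s(z', y') ∈ ω →
                ω ∈ openConnIn (↑(I.1 ∪ innerBoundary (zdGraph d) (box d (σ μ₂))) : Set (Site d)) z z'})) with hG
  set CO := {ω : BondConfig (Site d) | ∃ x ∈ X, ∃ t ∈ T,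
            ω ∈ openConnIn ((↑W : Set (Site d)) \ ↑H) x t} with hCO
  -- `GOOD_in` is determined by the pairs of `Λ(s)`
  have hGdet : DeterminedBy G (↑((box d (σ μ₂)).sym2) : Set (Sym2 (Site d))) := by
    refine DeterminedBy.iUnion fun I => DeterminedBy.iUnion fun hI => ?_
    rw [Finset.mem_product, Finset.mem_powerset, Finset.mem_powerset] at hI
    have hT : {e : Sym2 (Site d) | e ∈ (↑((box d (σ μ₂)).sym2) : Set (Sym2 (Site d))) ∧
        ∃ v ∈ (↑(I.1 ∪ innerBoundary (zdGraph d) (box d (σ μ₂))) : Set (Site d)), v ∈ e} ⊆ ↑((box d (σ μ₂)).sym2) :=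
      fun e he => he.1
    exact ((determinedBy_idat (c := σ μ₁ - 1) (by omega : 1 ≤ σ μ₂) I.1 I.2).mono hT).inter
      ((determinedBy_ilink (by omega : σ μ₁ - 1 ≤ σ μ₂) hI.1 hI.2).mono hT)
  have hF : (box d (σ μ₂)).sym2 ⊆ (box d (σ M₁)).sym2 := Finset.sym2_mono (box_mono d hσμM)
  have h2 := sum_real_level_two_sided_target p hϰ hσ hστ hA2 (m₁ := M₁) (m₂ := M₂) (by omega) hM12'.le hM12 hW hTW hTb
    (hH.trans (box_mono d (by omega))) (hX.trans (box_mono d (by omega))) hXH hGdet hF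
  -- reorder the intersections in the summands
  have hsum : ∀ D : Finset (Site d) × Finset (Site d),
      G ∩ {ω : BondConfig (Site d) | ω ∩ (↑((box d (σ M₂ + 1)).sym2) : Set (Sym2 (Site d))) ∈
            explEvent (↑(box d (σ M₁)) : Set (Site d)) ((↑(box d (σ M₂)) : Set (Site d)) \ ↑(box d (σ M₁))) ↑D.1 ↑D.2} ∩
        {ω : BondConfig (Site d) | ∀ r ∈ D.2, ∀ r' ∈ D.2, ∃ v ∈ D.1, ∃ v' ∈ D.1,
            s(v, r) ∈ ω ∧ s(v', r') ∈ ω ∧ ω ∈ openConnIn ((↑D.1 : Set (Site d)) \ ↑(box d (σ M₁ - 1))) v v'} ∩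
        {ω : BondConfig (Site d) | ∃ x ∈ X, ∃ r ∈ D.2, ∃ v ∈ D.1, ω ∈ openConnIn ((↑D.1 : Set (Site d)) \ ↑H) x v ∧ s(v, r) ∈ ω} =
      G ∩ ({ω : BondConfig (Site d) | ∃ x ∈ X, ∃ r ∈ D.2, ∃ v ∈ D.1, ω ∈ openConnIn ((↑D.1 : Set (Site d)) \ ↑H) x v ∧ s(v, r) ∈ ω} ∩
        {ω : BondConfig (Site d) | ω ∩ (↑((box d (σ M₂ + 1)).sym2) : Set (Sym2 (Site d))) ∈
            explEvent (↑(box d (σ M₁)) : Set (Site d)) ((↑(box d (σ M₂)) : Set (Site d)) \ ↑(box d (σ M₁))) ↑D.1 ↑D.2} ∩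
        {ω : BondConfig (Site d) | ∀ r ∈ D.2, ∀ r' ∈ D.2, ∃ v ∈ D.1, ∃ v' ∈ D.1,
            s(v, r) ∈ ω ∧ s(v', r') ∈ ω ∧ ω ∈ openConnIn ((↑D.1 : Set (Site d)) \ ↑(box d (σ M₁ - 1))) v v'}) := by
    intro D; ext ω; simp only [Set.mem_inter_iff]; tauto
  simp only [hsum] at h2
  -- the GOOD_in complement inside CONN
  have hGm : MeasurableSet G := hGdet.measurableSet_of_finset
  have hsplit : μ.real CO = μ.real (CO ∩ G) + μ.real (CO \ G) := (measureReal_inter_add_sdiff₀ hGm.nullMeasurableSet).symm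
  have hjunk1 := real_inter_diff_goodIn_le p (c := σ μ₁ - 1) (s := σ μ₂) (by omega) CO
  rw [show σ μ₁ - 1 + 1 = σ μ₁ from by omega] at hjunk1
  have hτμM2 : τ μ₂ ≤ τ M₂ := hτm (hμM.trans hM12'.le)
  have hjunk2 := real_conn_inter_nonuniq_le_of_setToSetQM_target p hϰ.le hσ hστ hA2 (m₁ := μ₁) (m₂ := μ₂) (by omega)
    hμ12'.le hμ12 ((box_mono d hτμM2).trans hW) hTW (fun t ht h => hTb t ht (box_mono d hτμM2 h))
    hH hX hXH
  have hCG : μ.real (G ∩ CO) = μ.real (CO ∩ G) := by rw [Set.inter_comm]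
  have hϰ2 : 0 < ϰ ^ 2 := by positivity
  have hdiff : μ.real (CO \ G) ≤ ϰ⁻¹ ^ 2 * (μ.real (boxCrossing d (σ μ₁) (σ μ₂)) * μ.real CO) := by
    rw [inv_pow, le_inv_mul_iff₀ hϰ2]
    exact (mul_le_mul_of_nonneg_left hjunk1 hϰ2.le).trans hjunk2
  constructor
  · have hlow := h2.1
    rw [hCG] at hlow
    have : (1 - ϰ⁻¹ ^ 2 * (μ.real (boxCrossing d (σ μ₁) (σ μ₂)) + μ.real (boxCrossing d (σ M₁) (σ M₂)))) * μ.real CO ≤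
        μ.real (CO ∩ G) - ϰ⁻¹ ^ 2 * μ.real (boxCrossing d (σ M₁) (σ M₂)) * μ.real CO := by
      nlinarith [hsplit, hdiff]
    exact this.trans hlow
  · have hup := h2.2
    rw [hCG] at hup
    exact hup.trans (by linarith [hsplit, measureReal_nonneg (μ := μ) (s := CO \ G)])

end Summit.CriticalPhenomena.PercolationContinuityZ3.Theorems.Crossing

end
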